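import Mathlib
import Summits.ValiantsHypothesis.ValiantsHypothesis.Theorems.LiouvilleSarnakLiouvilleCutRankPeriodicDigits
import HarnessLib

/-!
# Route LiouvilleSarnak — crux `LiouvilleCutRank` (stmt-ValiantsHypothesis-14775):
# periodic instances `(C³R³)^m`, `(C⁴R⁴)^m` of the certificate theorem

`Theorems/LiouvilleSarnakLiouvilleCutRankPeriodicDigits.lean` (`periodicCutRank_of_certificate`) settles every periodic cut
pattern given a finite arithmetic certificate.  The block patterns `(C^k R^k)^m` for `k = 1, 2` are in the tree
(`…InterleavedUnbounded`, `…CcrrUnbounded`); `k = 3` is NOT reachable by the shift certificates (`λ(2^3+1) = λ(9) = +1`)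
but has the ratio certificate `q = 2` (`m_R = 56`, `λ(58) = +1 ≠ λ(2)`), and `k = 4` has `q = 1` (`m_R = 240`,
`λ(241) = -1 ≠ λ(1)`):

* `c3r3CutRank` — `(CCCRRR)^m`: `∀ W ∃ n₀ ∀ n ≥ n₀`, every cut of this shape at level `n` has rank `≥ W`.
* `c4r4CutRank` — `(CCCCRRRR)^m`: likewise.

Honest framing: two more explicit periodic families; `LiouvilleCutRank`, `DigitalBilinearLiouville`, `AlgebraicSarnak` stay
OPEN; nothing bears on `VP ≠ VNP`.  No definitions.
-/

set_option linter.dupNamespace false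

noncomputable section

namespace Summit.ValiantsHypothesis.ValiantsHypothesis.Theorems.LiouvilleSarnakLiouvilleCutRank.PeriodicInstances

open ArithmeticFunction Finset

open Summit.ValiantsHypothesis.ValiantsHypothesis.Theorems.LiouvilleSarnakLiouvilleCutRank.PeriodicDigits
  (periodicCutRank_of_certificate)

/-- `λ(58) = 1 ≠ -1 = λ(2)` (`58 = 2 · 29`). [folklore] -/
theorem liouville_58_ne_2 : liouville (56 + 2) ≠ liouville 2 := by
  have h2 : liouville 2 = -1 := by
    rw [liouville_apply two_ne_zero, cardFactors_apply_prime Nat.prime_two]; norm_num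
  have h29 : liouville 29 = -1 := by
    rw [liouville_apply (by norm_num : (29 : ℕ) ≠ 0), cardFactors_apply_prime (by norm_num : Nat.Prime 29)]; norm_num
  rw [show (56 : ℕ) + 2 = 2 * 29 by norm_num, liouville_apply_mul, h2, h29]
  norm_num

/-- `λ(241) = -1 ≠ 1 = λ(1)` (`241` is prime). [folklore] -/
theorem liouville_241_ne_1 : liouville (240 + 1) ≠ liouville 1 := by
  rw [show (240 : ℕ) + 1 = 241 by norm_num, liouville_apply_one,
    liouville_apply (by norm_num : (241 : ℕ) ≠ 0), cardFactors_apply_prime (by norm_num : Nat.Prime 241)]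
  norm_num

/-- ★ `(CCCRRR)^m` has unbounded cut rank: period `6`, column offsets `0,1,2`, row offsets `3,4,5`, certificate `q = 2`.
[this file] -/
theorem c3r3CutRank (W : ℕ) : ∃ n₀ : ℕ, ∀ n ≥ n₀, ∀ π : Fin n ⊕ Fin n ≃ Fin (2 * n),
    (∀ i : Fin n, (π (Sum.inl i) : ℕ) = 6 * ((i : ℕ) / 3) + (fun t : ℕ => t + 3) ((i : ℕ) % 3) ∧
      (π (Sum.inr i) : ℕ) = 6 * ((i : ℕ) / 3) + (fun t : ℕ => t) ((i : ℕ) % 3)) →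
      W ≤ (Matrix.of fun r c : Fin n → Bool =>
        (((liouville (Nat.ofBits (fun k : Fin (2 * n) => Sum.elim r c (π.symm k)) + 1) : ℤ) : ℂ))).rank := by
  have hm : (∑ t ∈ Finset.range 3, 2 ^ (fun t : ℕ => t + 3) t) + (∑ t ∈ Finset.range 3, 2 ^ (fun t : ℕ => t) t) + 1 =
      2 ^ 6 := by decide
  have hpq : (∑ t ∈ Finset.range 3, ((2 : ℕ).testBit t).toNat * 2 ^ (fun t : ℕ => t) t) = 2 := by decide
  have hpq' : (∑ t ∈ Finset.range 3, ((1 : ℕ).testBit t).toNat * 2 ^ (fun t : ℕ => t) t) = 2 - 1 := by decide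
  have hl : liouville ((∑ t ∈ Finset.range 3, 2 ^ (fun t : ℕ => t + 3) t) + 2) ≠ liouville 2 := by
    rw [show (∑ t ∈ Finset.range 3, 2 ^ (fun t : ℕ => t + 3) t) = 56 by decide]
    exact liouville_58_ne_2
  exact periodicCutRank_of_certificate 3 6 (by norm_num) (fun t => t + 3) (fun t => t) hm 2 2 1 (by norm_num)
    (by norm_num) (by norm_num) hpq hpq' hl W

/-- ★ `(CCCCRRRR)^m` has unbounded cut rank: period `8`, column offsets `0..3`, row offsets `4..7`, certificate `q = 1`.
[this file] -/
theorem c4r4CutRank (W : ℕ) : ∃ n₀ : ℕ, ∀ n ≥ n₀, ∀ π : Fin n ⊕ Fin n ≃ Fin (2 * n),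
    (∀ i : Fin n, (π (Sum.inl i) : ℕ) = 8 * ((i : ℕ) / 4) + (fun t : ℕ => t + 4) ((i : ℕ) % 4) ∧
      (π (Sum.inr i) : ℕ) = 8 * ((i : ℕ) / 4) + (fun t : ℕ => t) ((i : ℕ) % 4)) →
      W ≤ (Matrix.of fun r c : Fin n → Bool =>
        (((liouville (Nat.ofBits (fun k : Fin (2 * n) => Sum.elim r c (π.symm k)) + 1) : ℤ) : ℂ))).rank := by
  have hm : (∑ t ∈ Finset.range 4, 2 ^ (fun t : ℕ => t + 4) t) + (∑ t ∈ Finset.range 4, 2 ^ (fun t : ℕ => t) t) + 1 =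
      2 ^ 8 := by decide
  have hpq : (∑ t ∈ Finset.range 4, ((1 : ℕ).testBit t).toNat * 2 ^ (fun t : ℕ => t) t) = 1 := by decide
  have hpq' : (∑ t ∈ Finset.range 4, ((0 : ℕ).testBit t).toNat * 2 ^ (fun t : ℕ => t) t) = 1 - 1 := by decide
  have hl : liouville ((∑ t ∈ Finset.range 4, 2 ^ (fun t : ℕ => t + 4) t) + 1) ≠ liouville 1 := by
    rw [show (∑ t ∈ Finset.range 4, 2 ^ (fun t : ℕ => t + 4) t) = 240 by decide]
    exact liouville_241_ne_1
  exact periodicCutRank_of_certificate 4 8 (by norm_num) (fun t => t + 4) (fun t => t) hm 1 1 0 le_rfl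
    (by norm_num) (by norm_num) hpq hpq' hl W

end Summit.ValiantsHypothesis.ValiantsHypothesis.Theorems.LiouvilleSarnakLiouvilleCutRank.PeriodicInstances

end
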